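import Literature.IUT.LogThetaLattice.LatticeGlueKummerSquareFormula
import HarnessLib

/-!
# [IUTchIII] Prop 2.1 (vi): the glue with the TRANSPORTED [IUTchII] Cor 4.10 (iv) unit-portion identification

Mochizuki, *Inter-universal Teichmüller Theory III*, kurims manuscript (May 2020), §2, Prop 2.1 (vi) pp.60–61 ("The
definition of the unit portion of the theta monoids involved [cf. [IUTchII], Corollary 4.10, (iv)] gives rise to natural
isomorphisms `†F^{⊢×}_△ ⥲ †F^{⊢×}_{env}`, `F^{⊢×}_△(†D^⊢_△) ⥲ F^{⊢×}_{env}(†D_>)` … compatible with the Kummer isomorphisms of (ii)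
above and Theorem 1.5, (iii)"); *II* (Dec 2020) Cor 4.10 (iv) p.160. [claim: Mochizuki2012, status: disputed] (D-0012
claim key). abc-iut cell, owner abc-iut-L6-t3 (gen 5); ONE definition (post-freeze def, reading (ii)) + theorems; sequel of
`LatticeGlueKummerSquareFormula.lean` (p430846: the Prop 2.1 (vi) Kummer square holds iff the Cor 4.10 (iv) identification
`linkData.unitPortion .nonGaussian` is the composite transported along the Kummer isomorphisms, and there is exactly one such).

WHAT THIS FILE DOES. For ANY glue `G : LatticeGlue S` it forms the glue `G.transportUnitPortion` with the SAME log-data,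
link pilots, Gaussian identification, `induced_full` clause, bi-coric / theta-monoid / coric data and the same eight
identifications, but with the non-Gaussian Cor 4.10 (iv) unit-portion identification REPLACED by the transported composite
`kummerT ≪≫ associator ≪≫ (htToD ◁ envNat) ≪≫ pilotEnvFxm_iso⁻¹` — i.e. the Frobenius-like `†F^{⊢×μ}_△ ⥲ †F^{⊢×μ}_{env}` DEFINED
through the unit portion exactly as print phrases it. For this glue the Prop 2.1 (vi) Kummer square is a THEOREM with no
hypothesis (`transportUnitPortion_kummerSquare`); it is Kummer-coherent iff the `ℝ_{>0}`-orbit law of Thm 1.5 (v) holds for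
`G.biCoric` (`transportUnitPortion_kummerCoherent_iff`), in particular whenever the orbits are full
(`transportUnitPortion_kummerCoherent_of_full`); and it coincides with `G` on the replaced datum iff `G` already satisfied
the square (`transportUnitPortion_unitPortion_eq_iff`). Applies verbatim to the real-frame glues `LatticeGlue.ofKits …` /
`LatticeGlue.ofPassages …`. Consumers of `LatticeGlue` (the Cor 3.12 crew's `Thm311.LinkData.ofGlue`) may take
`G.transportUnitPortion` wherever they take `G`.

Honest framing: a construction on OUR typed interfaces; which identification the genuine [IUTchII] Cor 4.10 (iv) datum IS
remains abc-iut-L6-t2's input BY NAME; no side taken on [IUTchIII] Cor 3.12; typed ≠ proved.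
-/

namespace Literature.IUT.LogThetaLattice

open CategoryTheory
open Literature.IUT.HodgeTheaters Literature.IUT.HodgeTheaters.PMBaseKit

universe u

namespace LatticeGlue

variable {S : StripFrame.{u}} (G : LatticeGlue S)

/-- **IUTchII:Cor4.10(iv)** (kurims p.160) the unit-portion identifications `†F^{⊢×μ}_△ ⥲ †F^{⊢×μ}_{env/gau}` of a glue with the
NON-GAUSSIAN one replaced by the composite transported along the Kummer isomorphisms of [IUTchIII] Thm 1.5 (iii) / Prop 2.1
(ii)(vi) (`kummerT ≪≫ associator ≪≫ (htToD ◁ envNat) ≪≫ pilotEnvFxm_iso⁻¹`); the Gaussian one is kept.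
[claim: Mochizuki2012, status: disputed] -/
def transportedUnitPortion :
    ∀ k : LatticeKind, G.linkData.pilotDelta ⋙ S.FglxmToFxm ≅ G.linkData.pilotTheta k ⋙ S.FglxmToFxm
  | .nonGaussian =>
      (G.kummerT ≪≫ Functor.associator S.htToD G.biCoric.dvDelta G.biCoric.fxmOfDv ≪≫
          Functor.isoWhiskerLeft S.htToD G.envNat) ≪≫ G.pilotEnvFxm_iso.symm
  | .gaussian => G.linkData.unitPortion LatticeKind.gaussian

/-- **IUTchIII:Prop2.1(vi)** (kurims p.61) **the glue with the transported unit-portion identification**: the same glued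
[IUTchIII] §1–§2 data as `G` (log-data, pilots, Gaussian identification, `induced_full`, bi-coric / theta-monoid / coric data,
the eight identifications) with `linkData.unitPortion .nonGaussian :=` the transported composite — the Frobenius-like
`†F^{⊢×μ}_△ ⥲ †F^{⊢×μ}_{env}` "defined [through] the unit portion of the theta monoids". [claim: Mochizuki2012, status: disputed] -/
def transportUnitPortion : LatticeGlue S where
  logData := G.logData
  linkData :=
    { pilotDelta := G.linkData.pilotDelta
      pilotTheta := G.linkData.pilotTheta
      unitPortion := G.transportedUnitPortion
      induced_full := G.linkData.induced_full }
  biCoric := G.biCoric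
  thetaMonoid := G.thetaMonoid
  coric := G.coric
  fglRoute_iso := G.fglRoute_iso
  fxmDeltaHT_iso := G.fxmDeltaHT_iso
  dvDelta_iso := G.dvDelta_iso
  fxmOfDv_iso := G.fxmOfDv_iso
  fxmOfDv_dv_compat := G.fxmOfDv_dv_compat
  fxmDeltaD_iso := G.fxmDeltaD_iso
  fglEnv_iso := G.fglEnv_iso
  pilotEnv_iso := G.pilotEnv_iso

/-! ### What is unchanged -/

/-- **IUTchIII:Def1.1(iii)** (kurims p.26) unchanged: the log-data. [claim: Mochizuki2012, status: disputed] -/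
theorem transportUnitPortion_logData : G.transportUnitPortion.logData = G.logData := rfl

/-- **IUTchIII:Thm1.5(iii)** (kurims p.48) unchanged: the bi-coric data. [claim: Mochizuki2012, status: disputed] -/
theorem transportUnitPortion_biCoric : G.transportUnitPortion.biCoric = G.biCoric := rfl

/-- **IUTchIII:Prop2.1(ii)** (kurims p.59) unchanged: the theta-monoid data. [claim: Mochizuki2012, status: disputed] -/
theorem transportUnitPortion_thetaMonoid : G.transportUnitPortion.thetaMonoid = G.thetaMonoid := rfl

/-- **IUTchIII:Cor2.3(i)** (kurims p.72) unchanged: the coric data. [claim: Mochizuki2012, status: disputed] -/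
theorem transportUnitPortion_coric : G.transportUnitPortion.coric = G.coric := rfl

/-- **IUTchII:Cor4.10(i)** (kurims p.158) unchanged: the pilot `†HT ↦ †F^{⊩▶×μ}_△`. [claim: Mochizuki2012, status: disputed] -/
theorem transportUnitPortion_pilotDelta : G.transportUnitPortion.linkData.pilotDelta = G.linkData.pilotDelta := rfl

/-- **IUTchII:Cor4.10(ii)** (kurims p.159) unchanged: the pilots `†HT ↦ †F^{⊩▶×μ}_{env/gau}`. [claim: Mochizuki2012, status: disputed] -/
theorem transportUnitPortion_pilotTheta : G.transportUnitPortion.linkData.pilotTheta = G.linkData.pilotTheta := rfl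

/-- **IUTchII:Cor4.10(iv)** (kurims p.160) unchanged: the GAUSSIAN unit-portion identification `†F^{⊢×μ}_△ ⥲ †F^{⊢×μ}_{gau}`.
[claim: Mochizuki2012, status: disputed] -/
theorem transportUnitPortion_unitPortion_gaussian :
    G.transportUnitPortion.linkData.unitPortion LatticeKind.gaussian = G.linkData.unitPortion LatticeKind.gaussian := rfl

/-- **IUTchII:Cor4.10(iv)** (kurims p.160) the REPLACED datum: the non-Gaussian unit-portion identification of
`G.transportUnitPortion` is the transported composite. [claim: Mochizuki2012, status: disputed] -/
theorem transportUnitPortion_unitPortion_nonGaussian :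
    G.transportUnitPortion.linkData.unitPortion LatticeKind.nonGaussian =
      (G.kummerT ≪≫ Functor.associator S.htToD G.biCoric.dvDelta G.biCoric.fxmOfDv ≪≫
          Functor.isoWhiskerLeft S.htToD G.envNat) ≪≫ G.pilotEnvFxm_iso.symm := rfl

/-- **IUTchIII:Thm1.5(iii)** (kurims p.50) unchanged: the Kummer isomorphism on the link-data copy. [claim: Mochizuki2012, status: disputed] -/
theorem transportUnitPortion_kummerT : G.transportUnitPortion.kummerT = G.kummerT := rfl

/-- **IUTchIII:Prop2.1(vi)** (kurims p.61) unchanged: the étale-like isomorphism `F^{⊢×μ}_△(†D^⊢_△) ⥲ F^{⊢×μ}_{env}(†D_>)`.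
[claim: Mochizuki2012, status: disputed] -/
theorem transportUnitPortion_envNat : G.transportUnitPortion.envNat = G.envNat := rfl

/-- **IUTchII:Cor4.10(iv)** (kurims p.160) unchanged: `(†F^{⊩▶×μ}_{env})^{⊢×μ} ≅ F^{⊢×μ}_{env}(†D_>)`. [claim: Mochizuki2012, status: disputed] -/
theorem transportUnitPortion_pilotEnvFxm_iso : G.transportUnitPortion.pilotEnvFxm_iso = G.pilotEnvFxm_iso := rfl

/-! ### What it buys: the Prop 2.1 (vi) Kummer square as a theorem -/

/-- **IUTchIII:Prop2.1(vi)** (kurims p.61) **For the glue with the transported unit-portion identification the Prop 2.1 (vi) Kummer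
square HOLDS** (no hypothesis): `unitPortion ≪≫ pilotEnvFxm_iso = kummerT ≪≫ associator ≪≫ (htToD ◁ envNat)` as natural
isomorphisms of functors `S.HT ⥤ S.Fxm`. [claim: Mochizuki2012, status: disputed] -/
theorem transportUnitPortion_kummerSquare :
    G.transportUnitPortion.linkData.unitPortion LatticeKind.nonGaussian ≪≫ G.transportUnitPortion.pilotEnvFxm_iso =
      G.transportUnitPortion.kummerT ≪≫
        Functor.associator S.htToD G.transportUnitPortion.biCoric.dvDelta G.transportUnitPortion.biCoric.fxmOfDv ≪≫
          Functor.isoWhiskerLeft S.htToD G.transportUnitPortion.envNat :=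
  G.transportUnitPortion.kummerSquare_iff_unitPortion_eq.mpr rfl

/-- **IUTchIII:Prop2.1(vi)** (kurims p.61) … hence at every Hodge theater: top route = bottom route (abc-iut-w4-d022's form of the
square) for `G.transportUnitPortion`. [claim: Mochizuki2012, status: disputed] -/
theorem transportUnitPortion_prop21vi_kummerSquare (X : S.HT) :
    (G.transportUnitPortion.linkData.unitPortion LatticeKind.nonGaussian).app X ≪≫
        G.transportUnitPortion.pilotEnvFxm_iso.app X =
      G.transportUnitPortion.kummerT.app X ≪≫ G.transportUnitPortion.envNat.app (S.htToD.obj X) :=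
  G.transportUnitPortion.prop21vi_kummerSquare_forall_iff_natIso.mpr G.transportUnitPortion_kummerSquare X

/-- **IUTchIII:Prop2.1(vi)** (kurims p.61) `G.transportUnitPortion` is Kummer-coherent IFF the `ℝ_{>0}`-orbit law of Thm 1.5 (v) holds for
the (unchanged) bi-coric data — the square half being a theorem. [claim: Mochizuki2012, status: disputed] -/
theorem transportUnitPortion_kummerCoherent_iff :
    G.transportUnitPortion.KummerCoherent ↔
      ∀ {X Y : S.HT} (ξ : X ≅ Y)
        (e : G.biCoric.realifiedHT.obj X ≅ G.biCoric.realified.obj (G.biCoric.dvDelta.obj (S.htToD.obj X))),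
        e ∈ G.biCoric.realifiedKummer X →
          (G.biCoric.realifiedHT.mapIso ξ).symm ≪≫ e ≪≫
              G.biCoric.realified.mapIso (G.biCoric.dvDelta.mapIso (S.htToD.mapIso ξ)) ∈
            G.biCoric.realifiedKummer Y :=
  ⟨fun h => h.realifiedKummer_map, fun h => ⟨G.transportUnitPortion_kummerSquare, h⟩⟩

/-- **IUTchIII:Thm1.5(v)** (kurims p.51) … in particular `G.transportUnitPortion` is Kummer-coherent whenever every `ℝ_{>0}`-orbit of `G` is
the full poly-isomorphism (the reading in which the realified Hom-sets are `ℝ_{>0}`-torsors). [claim: Mochizuki2012, status: disputed] -/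
theorem transportUnitPortion_kummerCoherent_of_full (hfull : ∀ X : S.HT, G.biCoric.realifiedKummer X = PolyIso.full _ _) :
    G.transportUnitPortion.KummerCoherent :=
  G.transportUnitPortion_kummerCoherent_iff.mpr (G.biCoric.realifiedKummer_map_of_full hfull)

/-- **IUTchIII:Prop2.1(vi)** (kurims p.61) the replacement changes nothing iff `G` already satisfied the square: the transported
identification equals `G`'s own non-Gaussian unit-portion identification iff the Prop 2.1 (vi) Kummer square holds for `G`.
[claim: Mochizuki2012, status: disputed] -/
theorem transportUnitPortion_unitPortion_eq_iff :
    G.transportUnitPortion.linkData.unitPortion LatticeKind.nonGaussian =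
        G.linkData.unitPortion LatticeKind.nonGaussian ↔
      G.linkData.unitPortion LatticeKind.nonGaussian ≪≫ G.pilotEnvFxm_iso =
        G.kummerT ≪≫ Functor.associator S.htToD G.biCoric.dvDelta G.biCoric.fxmOfDv ≪≫
          Functor.isoWhiskerLeft S.htToD G.envNat := by
  rw [transportUnitPortion_unitPortion_nonGaussian, kummerSquare_iff_unitPortion_eq]
  exact eq_comm

/-- **IUTchIII:Prop2.1(vi)** (kurims p.61) idempotence: transporting twice is transporting once (the transported composite of
`G.transportUnitPortion` is that of `G`). [claim: Mochizuki2012, status: disputed] -/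
theorem transportUnitPortion_transportUnitPortion :
    G.transportUnitPortion.transportUnitPortion = G.transportUnitPortion := rfl

end LatticeGlue

/-! ### The real frame and the toy kit stack -/

section Kit

variable {l : ℕ} {K : PMBaseKit.{u} l} {M : K.MultKit} {FK : K.FKit M}
  (L : FK.MonoLaws) (hbij : FK.IsomFtoDBijective) (hsurj : FK.IsomFmtoDmSurjective) (hR : FK.RlfOfIsStrip)
  (X : TimesMuSide FK L)
  (h : ∀ A B : X.Fglxm, Function.Surjective (fun g : A ≅ B => (X.FglxmToFvtxm ⋙ X.FvtxmToFxm).mapIso g))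
  (Gk : LatticeGlueKit hR X)

/-- **IUTchIII:Prop2.1(vi)** (kurims p.61) AT THE REAL FRAME: the glued data `LatticeGlue.ofKits … Gk` over `StripFrame.ofKits L hbij hsurj hR X`
with the transported unit-portion identification is Kummer-coherent IFF the kit-level `ℝ_{>0}`-orbit `Gk.biCoricKit.realifiedKummer`
satisfies the Thm 1.5 (v) transport law — the Prop 2.1 (vi) square needs NO kit-level input any more.
[claim: Mochizuki2012, status: disputed] -/
theorem LatticeGlue.ofKits_transportUnitPortion_kummerCoherent_iff :
    (LatticeGlue.ofKits L hbij hsurj hR X h Gk).transportUnitPortion.KummerCoherent ↔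
      ∀ {H H' : HTRep FK} (ξ : H ≅ H')
        (e : Gk.biCoricKit.realifiedHT.obj H ≅
          Gk.biCoricKit.realified.obj (Gk.biCoricKit.dvDelta.obj (HTRep.toDFunctor.obj H))),
        e ∈ Gk.biCoricKit.realifiedKummer H →
          (Gk.biCoricKit.realifiedHT.mapIso ξ).symm ≪≫ e ≪≫
              Gk.biCoricKit.realified.mapIso (Gk.biCoricKit.dvDelta.mapIso (HTRep.toDFunctor.mapIso ξ)) ∈
            Gk.biCoricKit.realifiedKummer H' :=
  ((LatticeGlue.ofKits L hbij hsurj hR X h Gk).transportUnitPortion_kummerCoherent_iff).trans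
    (BiCoricData.ofKits_realifiedKummer_map_iff L hbij hsurj hR X Gk.biCoricKit)

end Kit

namespace KitsToy

variable (l : ℕ) [Fact l.Prime] (hl : l ≠ 2)

/-- **IUTchIII:Prop2.1(vi)** (kurims p.61) over abc-iut-L5-t4's toy kits: `KitsToy.latticeGlue` with the transported identification is
Kummer-coherent with NO input (its kit-level `ℝ_{>0}`-orbit is the full poly-isomorphism). [claim: Mochizuki2012, status: disputed] -/
theorem latticeGlue_transportUnitPortion_kummerCoherent :
    (latticeGlue l hl).transportUnitPortion.KummerCoherent :=
  (LatticeGlue.ofKits_transportUnitPortion_kummerCoherent_iff (FKit.MonoLaws.toy l hl) (FKit.isomFtoDBijective_toy l hl)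
      (FKit.isomFmtoDmSurjective_toy l hl) (FKit.rlfOfIsStrip_toy l hl) (timesMuSide l hl)
      (fglxmToFxm_mapIso_surjective l hl) (latticeGlueKit l hl)).mpr
    fun _ _ _ => PolyIso.mem_full _

end KitsToy

/-- **IUTchIII:Prop2.1(vi)** (kurims p.61) this seat's witness glue already carries the transported identification (all identities):
`twoGlue.transportUnitPortion`'s non-Gaussian unit portion is `twoGlue`'s. [claim: Mochizuki2012, status: disputed] -/
theorem Witness.twoGlue_transportUnitPortion_unitPortion :
    Witness.twoGlue.transportUnitPortion.linkData.unitPortion LatticeKind.nonGaussian =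
      Witness.twoGlue.linkData.unitPortion LatticeKind.nonGaussian :=
  Witness.twoGlue.transportUnitPortion_unitPortion_eq_iff.mpr Witness.twoGlue_kummerCoherent.kummerSquare

/-- **IUTchIII:Prop2.1(vi)** (kurims p.61) … whereas for abc-iut-w4-d022's variant `twoGlueNeg` (unit portion `−1`) transporting CHANGES the
datum — and repairs the square: `twoGlueNeg.transportUnitPortion` is Kummer-coherent. [claim: Mochizuki2012, status: disputed] -/
theorem Witness.twoGlueNeg_transportUnitPortion :
    Witness.twoGlueNeg.transportUnitPortion.linkData.unitPortion LatticeKind.nonGaussian ≠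
        Witness.twoGlueNeg.linkData.unitPortion LatticeKind.nonGaussian ∧
      Witness.twoGlueNeg.transportUnitPortion.KummerCoherent :=
  ⟨fun h => Witness.twoGlueNeg_unitPortion_ne_transported
      ((Witness.twoGlueNeg.transportUnitPortion_unitPortion_nonGaussian).symm.trans h).symm,
    Witness.twoGlueNeg.transportUnitPortion_kummerCoherent_of_full fun _ => rfl⟩

end Literature.IUT.LogThetaLattice
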